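import Summits.QuantumFields.YangMills.Theses.BalabanUVNodes
import Summits.QuantumFields.YangMills.Theorems.BalabanUVNodesN27AtShellSplitOfRecord13CoPHVCutProducersClassLaw

/-!
# BalabanUVNodes ∕ N27 — K3⁷ `SpineGivenEndpointR13SepCoPH` (stmt-QuantumFields-20544) FROM v3∕v4's `PinnedAtLive` SHAPE AT `(jc, shellSplitOfRecord₁₃At 2 K₀ ρA ρB)` WITH N19′ IN dag-n14-w2 g3's
# CLASS-LAW CURRENCIES — §1 ROAD (iii) NE7-S_cl (node U3's one-constant class-measure sandwich on the shell-free class laws of record) · §2 ROAD (iii)′ MASS_cl ∧ TV_cl DIRECT; N21 ⟸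
# dag-n21-d's (M1) rows; off the live line v3's K5 at a free `cr'` — leaf over storey XP2 `…N27AtShellSplitOfRecord13CoPHVCutProducersClassLaw`, sibling of XPL ∕ XPLF
# (cell `pub-ymgap`, HUMAN RULING D-0062 Track A, R134 seat `pub-ymgap-dag-n27-c` (N27 B5 composite, s2) gen 12, HOME trigger (t2‴); `--kind proof --supports 20544 --as helper`; COUNT-NEUTRAL;
# THEOREMS ONLY, 0 `def`, 0 `sorry`; imports `Theses.BalabanUVNodes` (target name) + XP2 ONLY)

WHAT IS KERNEL-CHECKED ([bookkeeping]; each theorem ⊢ `SpineGivenEndpointR13SepCoPH` BY NAME = `spine_rec13CCoPHOn_iff_forall_guarded` ∘ U's `spine_rec13CCoPHOn_of_split` with storey XP2 live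
(its `hrates` restricted by `hRg.1`) and v3's (P) `spine_rec13CCoPHOn_of_keyedFacesP` at `cr'` on `guard ∧ ¬LiveSel`, `hc := hP.toCore`; XPL §2's proof with the storey name swapped — nothing else).
★★★ §1 `spineGivenEndpointR13SepCoPH_of_liveShellSplitOfRecord₁₃VAt_cut_cubeAC_classSandwich_offLive_keyedFacesP` · ★★★ §2 `…_cut_cubeAC_massTV_offLive_keyedFacesP`.
BINDERS: `hrates hζm h20 hρA hρB hM1` + `h20' h21' hx' h19'` = XPL's VERBATIM; `h19` = XP2 §1's ∕ §2's at `N := 2, G := guard` (dag-n14-w2 g3's `hS`+`r` ∕ `hM hTV r₁ ρ` rows under the rates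
premise).  Consumed BY NAME: XP2 (this seat), U's split + `…_iff_forall_guarded` (dag-n27-w1), v3's (P) `spine_rec13CCoPHOn_of_keyedFacesP` (dag-n19-w3).  Nothing landed is edited.

HONEST FRAMING.  COMPOSITE-node bookkeeping over landed theorems; every antecedent is a HYPOTHESIS SHAPE inhabited for no family today (K0⁷ `Nonempty (Stage13HParams F 2)` OPEN); the
class-law sentences are node U3's UNPRINTED two-run statements for d = 4, produced by nobody; (M1), the rates `P`, the N20 witness and the off-live K5 rows likewise; `K₀ jc ρA ρB cr' rr P`
FREE — no reading minted; nothing of Bałaban's asserted or instantiated; N14 ∕ N19 ∕ N20 ∕ N21 ∕ N27 NOT discharged; K3⁷ NOT claimed (item OPEN; skeleton v4 17c74fac127b5f61 untouched);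
counts UNMOVED (typed 28∕28 · discharged 5∕27, A 5∕28); one finite four-torus programme at fixed `ε` — NOT ℝ⁴, NOT infinite volume, NOT OS, NOT a mass gap, NOT Clay.  No cite tag below.
-/

set_option autoImplicit false

noncomputable section

namespace Summit.QuantumFields.YangMills.Theorems.BalabanUVNodesN27SpineRecord

open scoped BigOperators
open MeasureTheory
open Literature.MathematicalPhysics.QuantumFieldTheory.Balaban1983to89
open Literature.MathematicalPhysics.QuantumFieldTheory.Balaban1983to89.T4Continuum
open Literature.MathematicalPhysics.QuantumFieldTheory.Balaban1983to89.Node00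
open T4WeightBudget (RelWeightBound)
open T4IndicatorShell (ShellWeightBound)
open T4ContinuumYM4Torus (ForSmallCouplings)
open Summit.QuantumFields.BalabanUV.T4Continuum.Spine
open Summit.QuantumFields.YangMills.Theses.BalabanUVNodes (SpineGivenEndpointR13SepCoPH)
open YMDAG.UVSplit
open Summit.QuantumFields.YangMills.BalabanUVNodes.N19TargetClassWeightsE1Keyed
open Summit.QuantumFields.YangMills.Theorems.N21ShellSplitOfRecord13CoPH (WidthLetter₁₃CoPH shellSplitOfRecord₁₃At shellA₁₃ shellB₁₃ shellPieceOfDatum₉ cubeWeightOfDatum₉)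
open YMDAG.N14.AtSpineReading13CoPH (classMeasA₁₃ classMeasB₁₃)
open YMDAG.N14.AtSpineReading13CoPH.Shell (shellMeasA₁₃ shellMeasB₁₃)

variable (K₀ : ℕ) (jc : (F : T4Family) → (θ : Stage13HParams F 2) → θ.Provisos₁₃CoPH F 2 → (ℕ → ℝ) → List (ULoop F) → ℕ → ℕ)
  (ρA ρB : WidthLetter₁₃CoPH 2)
  (cr' : (F : T4Family) → (θ : Stage13HParams F 2) → θ.Provisos₁₃CoPH F 2 → (ℕ → ℝ) → List (ULoop F) → SpineCarriers)
  (rr : (F : T4Family) → (θ : Stage13HParams F 2) → θ.Provisos₁₃CoPH F 2 → (ℕ → ℝ) → List (ULoop F) → RateCarriers 2)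
  (P : ∀ {F : T4Family}, Datum F 2 → RateCarriers 2 → Prop)

/-! ## §1 N19′ in dag-n14-w2 g3's ROAD (iii): the one-constant class-measure sandwich -/

/-- ★★★ **K3⁷ IN v3∕v4's `PinnedAtLive` SHAPE AT `(jc, shellSplitOfRecord₁₃At 2 K₀ ρA ρB)` — N21 ⟸ dag-n21-d's (M1) rows, N19′ ⟸ dag-n14-w2 g3's ROAD (iii) NE7-S_cl: node U3's ONE-constant
CLASS-MEASURE sandwich on the pushed-forward shell-free class laws of record (`core_crOfRecord₁₃VAt_shellSplitOfRecord_of_classSandwich`), N20 a keyed witness, N27x ∕ (H-U) ∕ `0 ≤ ζ` theorems**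
(storey XP2 §1 on `guard ∧ LiveSel`, (P) at `cr'` on `guard ∧ ¬LiveSel`, U's split, `hc := hP.toCore`).  NOT a discharge; the class-measure sandwich and (M1) are HYPOTHESIS SHAPES produced
by nobody, NOT PRINTED for d = 4, NOT proved. [bookkeeping] -/
theorem spineGivenEndpointR13SepCoPH_of_liveShellSplitOfRecord₁₃VAt_cut_cubeAC_classSandwich_offLive_keyedFacesP
    (hrates : ∀ (F : T4Family) (θ : Stage13HParams F 2) (hP : θ.Provisos₁₃CoPH F 2), (θ.ZhUnity F 2 ∧ θ.SlotsNondegenerate₁₃ F 2) → θ.Admissible F 2 → ∀ (g₀ : ℕ → ℝ) (os : List (ULoop F)),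
      P (datumOfRecord₁₃CoPH F 2 θ hP) (rr F θ hP g₀ os))
    (hζm : ∀ (F : T4Family) (θ : Stage13HParams F 2), θ.Provisos₁₃CoPH F 2 → ((θ.ZhUnity F 2 ∧ θ.SlotsNondegenerate₁₃ F 2) ∧ θ.ppSel = ppSelLiveOfRecord F 2 θ.ν θ.τ9 (EOfRecord₁₃ F 2 θ.toStage13Params) (wOfRecord₉ F 2 θ.toStage9Params)) → θ.Admissible F 2 → ZetaMeasurable F 2 θ.ζ)
    (h20 : ∀ (F : T4Family) (θ : Stage13HParams F 2) (hP : θ.Provisos₁₃CoPH F 2), ((θ.ZhUnity F 2 ∧ θ.SlotsNondegenerate₁₃ F 2) ∧ θ.ppSel = ppSelLiveOfRecord F 2 θ.ν θ.τ9 (EOfRecord₁₃ F 2 θ.toStage13Params) (wOfRecord₉ F 2 θ.toStage9Params)) → θ.Admissible F 2 → ∀ (g₀ : ℕ → ℝ) (os : List (ULoop F)),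
      ∃ W : ℕ → ℝ, RelWeightBound 1 (classSet₁₃ θ K₀ g₀) (weightA₁₃ θ hP K₀ g₀ os) (weightB₁₃ θ hP K₀ g₀ os) (badClass₁₃ θ K₀ g₀ (jc F θ hP g₀ os)) W)
    (hρA : ∀ (F : T4Family) (θ : Stage13HParams F 2) (hP : θ.Provisos₁₃CoPH F 2),
      ((θ.ZhUnity F 2 ∧ θ.SlotsNondegenerate₁₃ F 2) ∧ θ.ppSel = ppSelLiveOfRecord F 2 θ.ν θ.τ9 (EOfRecord₁₃ F 2 θ.toStage13Params) (wOfRecord₉ F 2 θ.toStage9Params)) → θ.Admissible F 2 →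
        ∀ (g₀ : ℕ → ℝ) (os : List (ULoop F)) (K : ℕ), 0 ≤ ρA F θ hP g₀ os K)
    (hρB : ∀ (F : T4Family) (θ : Stage13HParams F 2) (hP : θ.Provisos₁₃CoPH F 2),
      ((θ.ZhUnity F 2 ∧ θ.SlotsNondegenerate₁₃ F 2) ∧ θ.ppSel = ppSelLiveOfRecord F 2 θ.ν θ.τ9 (EOfRecord₁₃ F 2 θ.toStage13Params) (wOfRecord₉ F 2 θ.toStage9Params)) → θ.Admissible F 2 →
        ∀ (g₀ : ℕ → ℝ) (os : List (ULoop F)) (K : ℕ), 0 ≤ ρB F θ hP g₀ os K)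
    (hM1 : ∀ (F : T4Family) (θ : Stage13HParams F 2) (hP : θ.Provisos₁₃CoPH F 2),
      ((θ.ZhUnity F 2 ∧ θ.SlotsNondegenerate₁₃ F 2) ∧ θ.ppSel = ppSelLiveOfRecord F 2 θ.ν θ.τ9 (EOfRecord₁₃ F 2 θ.toStage13Params) (wOfRecord₉ F 2 θ.toStage9Params)) → θ.Admissible F 2 →
        ∀ (g₀ : ℕ → ℝ) (os : List (ULoop F)), ∃ DA DB : ℕ → ℝ, (∀ K, 0 ≤ DA K) ∧ (∀ K, 0 ≤ DB K) ∧
          Summable (fun K => DA K * ρA F θ hP g₀ os K) ∧ Summable (fun K => DB K * ρB F θ hP g₀ os K) ∧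
          (∀ (K : ℕ) (t : ℝ), |t| ≤ 1 →
            ∀ a : ↥(cubeIndices (F.P (K₀ + K)) (cubeSide (F.P (K₀ + K)).L θ.ν.M₂ (RkOfRecord (F.P (K₀ + K)).L θ.ν.r (histA₁₃ θ K₀ g₀ K (K₀ + K))) (K₀ + K))),
              ∑ s, shellPieceOfDatum₉ F 2 θ.toStage9Params (datumOfRecord₁₃CoPH F 2 θ hP) g₀ os (runA₁₃ F K₀ g₀ K) (histA₁₃ θ K₀ g₀ K) (K₀ + K)
                  (ρA F θ hP g₀ os K) t a s ≤
                (DA K * ρA F θ hP g₀ os K) *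
                  ∑ s, cubeWeightOfDatum₉ F 2 θ.toStage9Params (datumOfRecord₁₃CoPH F 2 θ hP) g₀ os (runA₁₃ F K₀ g₀ K) (histA₁₃ θ K₀ g₀ K) (K₀ + K) t a s) ∧
          (∀ (K : ℕ) (t : ℝ), |t| ≤ 1 →
            ∀ a : ↥(cubeIndices (F.P (K₀ + K + 1)) (cubeSide (F.P (K₀ + K + 1)).L θ.ν.M₂
                (RkOfRecord (F.P (K₀ + K + 1)).L θ.ν.r (histB₁₃ θ K₀ g₀ K (K₀ + K + 1))) (K₀ + K + 1))),
              ∑ s', shellPieceOfDatum₉ F 2 θ.toStage9Params (datumOfRecord₁₃CoPH F 2 θ hP) g₀ os (runB₁₃ F K₀ g₀ K) (histB₁₃ θ K₀ g₀ K) (K₀ + K + 1)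
                  (ρB F θ hP g₀ os K) t a s' ≤
                (DB K * ρB F θ hP g₀ os K) *
                  ∑ s', cubeWeightOfDatum₉ F 2 θ.toStage9Params (datumOfRecord₁₃CoPH F 2 θ hP) g₀ os (runB₁₃ F K₀ g₀ K) (histB₁₃ θ K₀ g₀ K) (K₀ + K + 1) t a s'))
    (h19 : ∀ (F : T4Family) (θ : Stage13HParams F 2) (hP : θ.Provisos₁₃CoPH F 2), ((θ.ZhUnity F 2 ∧ θ.SlotsNondegenerate₁₃ F 2) ∧ θ.ppSel = ppSelLiveOfRecord F 2 θ.ν θ.τ9 (EOfRecord₁₃ F 2 θ.toStage13Params) (wOfRecord₉ F 2 θ.toStage9Params)) → θ.Admissible F 2 →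
      ∀ (g₀ : ℕ → ℝ) (os : List (ULoop F)), P (datumOfRecord₁₃CoPH F 2 θ hP) (rr F θ hP g₀ os) → letI : DecidableEq (Σ K, SiteSeqKey F (K₀ + K)) := Classical.decEq _
        ∃ r : ℕ → ℝ, Summable r ∧
      (∀ K : ℕ, ∃ c : ℝ, ∀ t : ℝ, |t| ≤ 1 → ∀ x ∈ classSet₁₃ θ K₀ g₀ K \ badClass₁₃ θ K₀ g₀ (jc F θ hP g₀ os) K t,
        ENNReal.ofReal (Real.exp (c - r K)) • (classMeasA₁₃ θ K₀ g₀ K x - shellMeasA₁₃ θ K₀ g₀ (ρA F θ hP g₀ os) K x).map ((T4RunLadder.unitFactorisation (datumOfRecord₁₃CoPH F 2 θ hP) (isPrintedAveraged_datumOfRecord₁₃CoPH F 2 θ hP).avgMeasurable g₀).A (K₀ + K)) ≤ (classMeasB₁₃ θ K₀ g₀ K x - shellMeasB₁₃ θ K₀ g₀ (ρB F θ hP g₀ os) K x).map ((T4RunLadder.unitFactorisation (datumOfRecord₁₃CoPH F 2 θ hP) (isPrintedAveraged_datumOfRecord₁₃CoPH F 2 θ hP).avgMeasurable g₀).A (K₀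 + K + 1)) ∧
        (classMeasB₁₃ θ K₀ g₀ K x - shellMeasB₁₃ θ K₀ g₀ (ρB F θ hP g₀ os) K x).map ((T4RunLadder.unitFactorisation (datumOfRecord₁₃CoPH F 2 θ hP) (isPrintedAveraged_datumOfRecord₁₃CoPH F 2 θ hP).avgMeasurable g₀).A (K₀ + K + 1)) ≤ ENNReal.ofReal (Real.exp (c + r K)) • (classMeasA₁₃ θ K₀ g₀ K x - shellMeasA₁₃ θ K₀ g₀ (ρA F θ hP g₀ os) K x).map ((T4RunLadder.unitFactorisation (datumOfRecord₁₃CoPH F 2 θ hP) (isPrintedAveraged_datumOfRecord₁₃CoPH F 2 θ hP).avgMeasurable g₀).A (K₀ + K))))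
    (h20' : ∀ (F : T4Family) (θ : Stage13HParams F 2) (hP : θ.Provisos₁₃CoPH F 2), ((θ.ZhUnity F 2 ∧ θ.SlotsNondegenerate₁₃ F 2) ∧ ¬ θ.ppSel = ppSelLiveOfRecord F 2 θ.ν θ.τ9 (EOfRecord₁₃ F 2 θ.toStage13Params) (wOfRecord₉ F 2 θ.toStage9Params)) → θ.Admissible F 2 → ∀ (g₀ : ℕ → ℝ) (os : List (ULoop F)),
      RelWeightBound (cr' F θ hP g₀ os).l₀ (cr' F θ hP g₀ os).T (cr' F θ hP g₀ os).A (cr' F θ hP g₀ os).B (cr' F θ hP g₀ os).Bad (cr' F θ hP g₀ os).W)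
    (h21' : ∀ (F : T4Family) (θ : Stage13HParams F 2) (hP : θ.Provisos₁₃CoPH F 2), ((θ.ZhUnity F 2 ∧ θ.SlotsNondegenerate₁₃ F 2) ∧ ¬ θ.ppSel = ppSelLiveOfRecord F 2 θ.ν θ.τ9 (EOfRecord₁₃ F 2 θ.toStage13Params) (wOfRecord₉ F 2 θ.toStage9Params)) → θ.Admissible F 2 → ∀ (g₀ : ℕ → ℝ) (os : List (ULoop F)),
      ShellWeightBound (cr' F θ hP g₀ os).l₀ (cr' F θ hP g₀ os).T (cr' F θ hP g₀ os).A (cr' F θ hP g₀ os).B (cr' F θ hP g₀ os).shA (cr' F θ hP g₀ os).shB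
        (cr' F θ hP g₀ os).Wsh)
    (hx' : ∀ (F : T4Family) (θ : Stage13HParams F 2) (hP : θ.Provisos₁₃CoPH F 2), ((θ.ZhUnity F 2 ∧ θ.SlotsNondegenerate₁₃ F 2) ∧ ¬ θ.ppSel = ppSelLiveOfRecord F 2 θ.ν θ.τ9 (EOfRecord₁₃ F 2 θ.toStage13Params) (wOfRecord₉ F 2 θ.toStage9Params)) → θ.Admissible F 2 →
      B16.EndStatementBPrinted (datumOfRecord₁₃CoPH F 2 θ hP).C → DagBinding.EndpointExistence (datumOfRecord₁₃CoPH F 2 θ hP).C.toB12 →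
        ForSmallCouplings (datumOfRecord₁₃CoPH F 2 θ hP) fun g₀ => ∀ os : List (ULoop F),
          0 < (cr' F θ hP g₀ os).l₀ ∧ 0 < (cr' F θ hP g₀ os).vol ∧
          (∀ (K : ℕ) (t : ℝ), |t| ≤ (cr' F θ hP g₀ os).l₀ →
            T4GenFunBounds.schemeZ ((datumOfRecord₁₃CoPH F 2 θ hP).scheme g₀) os ((cr' F θ hP g₀ os).K₀ + K) t =
              ∑ τ ∈ (cr' F θ hP g₀ os).T K, (cr' F θ hP g₀ os).A K t τ) ∧
          (∀ (K : ℕ) (t : ℝ), |t| ≤ (cr' F θ hP g₀ os).l₀ →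
            T4GenFunBounds.schemeZ ((datumOfRecord₁₃CoPH F 2 θ hP).scheme g₀) os ((cr' F θ hP g₀ os).K₀ + K + 1) t =
              ∑ τ ∈ (cr' F θ hP g₀ os).T K, (cr' F θ hP g₀ os).B K t τ))
    (h19' : ∀ (F : T4Family) (θ : Stage13HParams F 2) (hP : θ.Provisos₁₃CoPH F 2), ((θ.ZhUnity F 2 ∧ θ.SlotsNondegenerate₁₃ F 2) ∧ ¬ θ.ppSel = ppSelLiveOfRecord F 2 θ.ν θ.τ9 (EOfRecord₁₃ F 2 θ.toStage13Params) (wOfRecord₉ F 2 θ.toStage9Params)) → θ.Admissible F 2 → ∀ (g₀ : ℕ → ℝ) (os : List (ULoop F)),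
      P (datumOfRecord₁₃CoPH F 2 θ hP) (rr F θ hP g₀ os) → letI := (cr' F θ hP g₀ os).dec
        ∃ δ : ℕ → ℝ, NE7.Core (cr' F θ hP g₀ os).l₀ (cr' F θ hP g₀ os).vol (cr' F θ hP g₀ os).T (cr' F θ hP g₀ os).Bad
          (fun K t τ => (cr' F θ hP g₀ os).A K t τ - (cr' F θ hP g₀ os).shA K t τ) (fun K t τ => (cr' F θ hP g₀ os).B K t τ - (cr' F θ hP g₀ os).shB K t τ) δ ∧
          Summable δ) :
    SpineGivenEndpointR13SepCoPH :=
  fun F θ hP hG hθ _ _ =>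
    (spine_rec13CCoPHOn_iff_forall_guarded (fun F θ => θ.ZhUnity F 2 ∧ θ.SlotsNondegenerate₁₃ F 2)).mp
      (spine_rec13CCoPHOn_of_split (fun F θ => θ.ZhUnity F 2 ∧ θ.SlotsNondegenerate₁₃ F 2)
        (fun F (θ : Stage13HParams F 2) => θ.ppSel = ppSelLiveOfRecord F 2 θ.ν θ.τ9 (EOfRecord₁₃ F 2 θ.toStage13Params) (wOfRecord₉ F 2 θ.toStage9Params))
        (spine_rec13CCoPHOn_live_at_shellSplitOfRecord₁₃VAt_cut_of_keyedFacesP_cubeAC_classSandwich K₀ jc ρA ρB (fun F θ => θ.ZhUnity F 2 ∧ θ.SlotsNondegenerate₁₃ F 2) rr P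
          hζm h20 hρA hρB hM1 (fun F θ hP hRg hθ => hrates F θ hP hRg.1 hθ) h19)
        (spine_rec13CCoPHOn_of_keyedFacesP (cr := cr') (rr := rr)
          (Rg := fun F θ => (θ.ZhUnity F 2 ∧ θ.SlotsNondegenerate₁₃ F 2) ∧ ¬ θ.ppSel = ppSelLiveOfRecord F 2 θ.ν θ.τ9 (EOfRecord₁₃ F 2 θ.toStage13Params) (wOfRecord₉ F 2 θ.toStage9Params)) (P := P)
          h20' h21' (fun F θ hP hRg hθ => hrates F θ hP hRg.1 hθ) h19' hx'))
      F θ hP.toCore hG hθ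

/-! ## §2 N19′ in dag-n14-w2 g3's ROAD (iii)′: MASS_cl ∧ TV_cl direct -/

/-- ★★★ **K3⁷ IN v3∕v4's `PinnedAtLive` SHAPE AT `(jc, shellSplitOfRecord₁₃At 2 K₀ ρA ρB)` — N21 ⟸ dag-n21-d's (M1) rows, N19′ ⟸ dag-n14-w2 g3's ROAD (iii)′ MASS_cl ∧ TV_cl of the
shell-free class laws of record DIRECTLY (`core_crOfRecord₁₃VAt_shellSplitOfRecord_of_massSandwich_of_tv`), N20 a keyed witness, N27x ∕ (H-U) ∕ `0 ≤ ζ` theorems** (storey XP2 §2 on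
`guard ∧ LiveSel`, (P) at `cr'` off it).  NOT a discharge; MASS_cl, TV_cl and (M1) are HYPOTHESIS SHAPES produced by nobody, NOT PRINTED for d = 4, NOT proved. [bookkeeping] -/
theorem spineGivenEndpointR13SepCoPH_of_liveShellSplitOfRecord₁₃VAt_cut_cubeAC_massTV_offLive_keyedFacesP
    (hrates : ∀ (F : T4Family) (θ : Stage13HParams F 2) (hP : θ.Provisos₁₃CoPH F 2), (θ.ZhUnity F 2 ∧ θ.SlotsNondegenerate₁₃ F 2) → θ.Admissible F 2 → ∀ (g₀ : ℕ → ℝ) (os : List (ULoop F)),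
      P (datumOfRecord₁₃CoPH F 2 θ hP) (rr F θ hP g₀ os))
    (hζm : ∀ (F : T4Family) (θ : Stage13HParams F 2), θ.Provisos₁₃CoPH F 2 → ((θ.ZhUnity F 2 ∧ θ.SlotsNondegenerate₁₃ F 2) ∧ θ.ppSel = ppSelLiveOfRecord F 2 θ.ν θ.τ9 (EOfRecord₁₃ F 2 θ.toStage13Params) (wOfRecord₉ F 2 θ.toStage9Params)) → θ.Admissible F 2 → ZetaMeasurable F 2 θ.ζ)
    (h20 : ∀ (F : T4Family) (θ : Stage13HParams F 2) (hP : θ.Provisos₁₃CoPH F 2), ((θ.ZhUnity F 2 ∧ θ.SlotsNondegenerate₁₃ F 2) ∧ θ.ppSel = ppSelLiveOfRecord F 2 θ.ν θ.τ9 (EOfRecord₁₃ F 2 θ.toStage13Params) (wOfRecord₉ F 2 θ.toStage9Params)) → θ.Admissible F 2 → ∀ (g₀ : ℕ → ℝ) (os : List (ULoop F)),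
      ∃ W : ℕ → ℝ, RelWeightBound 1 (classSet₁₃ θ K₀ g₀) (weightA₁₃ θ hP K₀ g₀ os) (weightB₁₃ θ hP K₀ g₀ os) (badClass₁₃ θ K₀ g₀ (jc F θ hP g₀ os)) W)
    (hρA : ∀ (F : T4Family) (θ : Stage13HParams F 2) (hP : θ.Provisos₁₃CoPH F 2),
      ((θ.ZhUnity F 2 ∧ θ.SlotsNondegenerate₁₃ F 2) ∧ θ.ppSel = ppSelLiveOfRecord F 2 θ.ν θ.τ9 (EOfRecord₁₃ F 2 θ.toStage13Params) (wOfRecord₉ F 2 θ.toStage9Params)) → θ.Admissible F 2 →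
        ∀ (g₀ : ℕ → ℝ) (os : List (ULoop F)) (K : ℕ), 0 ≤ ρA F θ hP g₀ os K)
    (hρB : ∀ (F : T4Family) (θ : Stage13HParams F 2) (hP : θ.Provisos₁₃CoPH F 2),
      ((θ.ZhUnity F 2 ∧ θ.SlotsNondegenerate₁₃ F 2) ∧ θ.ppSel = ppSelLiveOfRecord F 2 θ.ν θ.τ9 (EOfRecord₁₃ F 2 θ.toStage13Params) (wOfRecord₉ F 2 θ.toStage9Params)) → θ.Admissible F 2 →
        ∀ (g₀ : ℕ → ℝ) (os : List (ULoop F)) (K : ℕ), 0 ≤ ρB F θ hP g₀ os K)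
    (hM1 : ∀ (F : T4Family) (θ : Stage13HParams F 2) (hP : θ.Provisos₁₃CoPH F 2),
      ((θ.ZhUnity F 2 ∧ θ.SlotsNondegenerate₁₃ F 2) ∧ θ.ppSel = ppSelLiveOfRecord F 2 θ.ν θ.τ9 (EOfRecord₁₃ F 2 θ.toStage13Params) (wOfRecord₉ F 2 θ.toStage9Params)) → θ.Admissible F 2 →
        ∀ (g₀ : ℕ → ℝ) (os : List (ULoop F)), ∃ DA DB : ℕ → ℝ, (∀ K, 0 ≤ DA K) ∧ (∀ K, 0 ≤ DB K) ∧
          Summable (fun K => DA K * ρA F θ hP g₀ os K) ∧ Summable (fun K => DB K * ρB F θ hP g₀ os K) ∧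
          (∀ (K : ℕ) (t : ℝ), |t| ≤ 1 →
            ∀ a : ↥(cubeIndices (F.P (K₀ + K)) (cubeSide (F.P (K₀ + K)).L θ.ν.M₂ (RkOfRecord (F.P (K₀ + K)).L θ.ν.r (histA₁₃ θ K₀ g₀ K (K₀ + K))) (K₀ + K))),
              ∑ s, shellPieceOfDatum₉ F 2 θ.toStage9Params (datumOfRecord₁₃CoPH F 2 θ hP) g₀ os (runA₁₃ F K₀ g₀ K) (histA₁₃ θ K₀ g₀ K) (K₀ + K)
                  (ρA F θ hP g₀ os K) t a s ≤
                (DA K * ρA F θ hP g₀ os K) *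
                  ∑ s, cubeWeightOfDatum₉ F 2 θ.toStage9Params (datumOfRecord₁₃CoPH F 2 θ hP) g₀ os (runA₁₃ F K₀ g₀ K) (histA₁₃ θ K₀ g₀ K) (K₀ + K) t a s) ∧
          (∀ (K : ℕ) (t : ℝ), |t| ≤ 1 →
            ∀ a : ↥(cubeIndices (F.P (K₀ + K + 1)) (cubeSide (F.P (K₀ + K + 1)).L θ.ν.M₂
                (RkOfRecord (F.P (K₀ + K + 1)).L θ.ν.r (histB₁₃ θ K₀ g₀ K (K₀ + K + 1))) (K₀ + K + 1))),
              ∑ s', shellPieceOfDatum₉ F 2 θ.toStage9Params (datumOfRecord₁₃CoPH F 2 θ hP) g₀ os (runB₁₃ F K₀ g₀ K) (histB₁₃ θ K₀ g₀ K) (K₀ + K + 1)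
                  (ρB F θ hP g₀ os K) t a s' ≤
                (DB K * ρB F θ hP g₀ os K) *
                  ∑ s', cubeWeightOfDatum₉ F 2 θ.toStage9Params (datumOfRecord₁₃CoPH F 2 θ hP) g₀ os (runB₁₃ F K₀ g₀ K) (histB₁₃ θ K₀ g₀ K) (K₀ + K + 1) t a s'))
    (h19 : ∀ (F : T4Family) (θ : Stage13HParams F 2) (hP : θ.Provisos₁₃CoPH F 2), ((θ.ZhUnity F 2 ∧ θ.SlotsNondegenerate₁₃ F 2) ∧ θ.ppSel = ppSelLiveOfRecord F 2 θ.ν θ.τ9 (EOfRecord₁₃ F 2 θ.toStage13Params) (wOfRecord₉ F 2 θ.toStage9Params)) → θ.Admissible F 2 →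
      ∀ (g₀ : ℕ → ℝ) (os : List (ULoop F)), P (datumOfRecord₁₃CoPH F 2 θ hP) (rr F θ hP g₀ os) → letI : DecidableEq (Σ K, SiteSeqKey F (K₀ + K)) := Classical.decEq _
        ∃ r₁ ρ : ℕ → ℝ, Summable r₁ ∧ Summable ρ ∧
      (∀ K : ℕ, ∃ c : ℝ, ∀ t : ℝ, |t| ≤ 1 → ∀ x ∈ classSet₁₃ θ K₀ g₀ K \ badClass₁₃ θ K₀ g₀ (jc F θ hP g₀ os) K t,
        ENNReal.ofReal (Real.exp (c - r₁ K)) * (classMeasA₁₃ θ K₀ g₀ K x - shellMeasA₁₃ θ K₀ g₀ (ρA F θ hP g₀ os) K x) Set.univ ≤ (classMeasB₁₃ θ K₀ g₀ K x - shellMeasB₁₃ θ K₀ g₀ (ρB F θ hP g₀ os) K x) Set.univ ∧ (classMeasB₁₃ θ K₀ g₀ K x - shellMeasB₁₃ θ K₀ g₀ (ρB F θ hP g₀ os) K x) Set.univ ≤ ENNReal.ofReal (Real.exp (c + r₁ K)) * (classMeasA₁₃ θ K₀ g₀ K x - shellMeasA₁₃ θ K₀ g₀ (ρA F θ hP g₀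 os) K x) Set.univ) ∧
      (∀ (K : ℕ) (t : ℝ), |t| ≤ 1 → ∀ x ∈ classSet₁₃ θ K₀ g₀ K \ badClass₁₃ θ K₀ g₀ (jc F θ hP g₀ os) K t, ∀ S : Set (GaugeField (F.P 0) 0 (Node00.SU 2)), MeasurableSet S →
        |((classMeasB₁₃ θ K₀ g₀ K x - shellMeasB₁₃ θ K₀ g₀ (ρB F θ hP g₀ os) K x).map ((T4RunLadder.unitFactorisation (datumOfRecord₁₃CoPH F 2 θ hP) (isPrintedAveraged_datumOfRecord₁₃CoPH F 2 θ hP).avgMeasurable g₀).A (K₀ + K + 1))).real S / ((classMeasB₁₃ θ K₀ g₀ K x - shellMeasB₁₃ θ K₀ g₀ (ρB F θ hP g₀ os) K x).map ((T4RunLadder.unitFactorisation (datumOfRecord₁₃CoPH F 2 θ hP) (isPrintedAveraged_datumOfRecord₁₃CoPH F 2 θ hP).avgMeasurable g₀).A (K₀ + K + 1))).real Set.univ -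
          ((classMeasA₁₃ θ K₀ g₀ K x - shellMeasA₁₃ θ K₀ g₀ (ρA F θ hP g₀ os) K x).map ((T4RunLadder.unitFactorisation (datumOfRecord₁₃CoPH F 2 θ hP) (isPrintedAveraged_datumOfRecord₁₃CoPH F 2 θ hP).avgMeasurable g₀).A (K₀ + K))).real S / ((classMeasA₁₃ θ K₀ g₀ K x - shellMeasA₁₃ θ K₀ g₀ (ρA F θ hP g₀ os) K x).map ((T4RunLadder.unitFactorisation (datumOfRecord₁₃CoPH F 2 θ hP) (isPrintedAveraged_datumOfRecord₁₃CoPH F 2 θ hP).avgMeasurable g₀).A (K₀ + K))).real Set.univ| ≤ ρ K))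
    (h20' : ∀ (F : T4Family) (θ : Stage13HParams F 2) (hP : θ.Provisos₁₃CoPH F 2), ((θ.ZhUnity F 2 ∧ θ.SlotsNondegenerate₁₃ F 2) ∧ ¬ θ.ppSel = ppSelLiveOfRecord F 2 θ.ν θ.τ9 (EOfRecord₁₃ F 2 θ.toStage13Params) (wOfRecord₉ F 2 θ.toStage9Params)) → θ.Admissible F 2 → ∀ (g₀ : ℕ → ℝ) (os : List (ULoop F)),
      RelWeightBound (cr' F θ hP g₀ os).l₀ (cr' F θ hP g₀ os).T (cr' F θ hP g₀ os).A (cr' F θ hP g₀ os).B (cr' F θ hP g₀ os).Bad (cr' F θ hP g₀ os).W)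
    (h21' : ∀ (F : T4Family) (θ : Stage13HParams F 2) (hP : θ.Provisos₁₃CoPH F 2), ((θ.ZhUnity F 2 ∧ θ.SlotsNondegenerate₁₃ F 2) ∧ ¬ θ.ppSel = ppSelLiveOfRecord F 2 θ.ν θ.τ9 (EOfRecord₁₃ F 2 θ.toStage13Params) (wOfRecord₉ F 2 θ.toStage9Params)) → θ.Admissible F 2 → ∀ (g₀ : ℕ → ℝ) (os : List (ULoop F)),
      ShellWeightBound (cr' F θ hP g₀ os).l₀ (cr' F θ hP g₀ os).T (cr' F θ hP g₀ os).A (cr' F θ hP g₀ os).B (cr' F θ hP g₀ os).shA (cr' F θ hP g₀ os).shB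
        (cr' F θ hP g₀ os).Wsh)
    (hx' : ∀ (F : T4Family) (θ : Stage13HParams F 2) (hP : θ.Provisos₁₃CoPH F 2), ((θ.ZhUnity F 2 ∧ θ.SlotsNondegenerate₁₃ F 2) ∧ ¬ θ.ppSel = ppSelLiveOfRecord F 2 θ.ν θ.τ9 (EOfRecord₁₃ F 2 θ.toStage13Params) (wOfRecord₉ F 2 θ.toStage9Params)) → θ.Admissible F 2 →
      B16.EndStatementBPrinted (datumOfRecord₁₃CoPH F 2 θ hP).C → DagBinding.EndpointExistence (datumOfRecord₁₃CoPH F 2 θ hP).C.toB12 →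
        ForSmallCouplings (datumOfRecord₁₃CoPH F 2 θ hP) fun g₀ => ∀ os : List (ULoop F),
          0 < (cr' F θ hP g₀ os).l₀ ∧ 0 < (cr' F θ hP g₀ os).vol ∧
          (∀ (K : ℕ) (t : ℝ), |t| ≤ (cr' F θ hP g₀ os).l₀ →
            T4GenFunBounds.schemeZ ((datumOfRecord₁₃CoPH F 2 θ hP).scheme g₀) os ((cr' F θ hP g₀ os).K₀ + K) t =
              ∑ τ ∈ (cr' F θ hP g₀ os).T K, (cr' F θ hP g₀ os).A K t τ) ∧
          (∀ (K : ℕ) (t : ℝ), |t| ≤ (cr' F θ hP g₀ os).l₀ →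
            T4GenFunBounds.schemeZ ((datumOfRecord₁₃CoPH F 2 θ hP).scheme g₀) os ((cr' F θ hP g₀ os).K₀ + K + 1) t =
              ∑ τ ∈ (cr' F θ hP g₀ os).T K, (cr' F θ hP g₀ os).B K t τ))
    (h19' : ∀ (F : T4Family) (θ : Stage13HParams F 2) (hP : θ.Provisos₁₃CoPH F 2), ((θ.ZhUnity F 2 ∧ θ.SlotsNondegenerate₁₃ F 2) ∧ ¬ θ.ppSel = ppSelLiveOfRecord F 2 θ.ν θ.τ9 (EOfRecord₁₃ F 2 θ.toStage13Params) (wOfRecord₉ F 2 θ.toStage9Params)) → θ.Admissible F 2 → ∀ (g₀ : ℕ → ℝ) (os : List (ULoop F)),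
      P (datumOfRecord₁₃CoPH F 2 θ hP) (rr F θ hP g₀ os) → letI := (cr' F θ hP g₀ os).dec
        ∃ δ : ℕ → ℝ, NE7.Core (cr' F θ hP g₀ os).l₀ (cr' F θ hP g₀ os).vol (cr' F θ hP g₀ os).T (cr' F θ hP g₀ os).Bad
          (fun K t τ => (cr' F θ hP g₀ os).A K t τ - (cr' F θ hP g₀ os).shA K t τ) (fun K t τ => (cr' F θ hP g₀ os).B K t τ - (cr' F θ hP g₀ os).shB K t τ) δ ∧
          Summable δ) :
    SpineGivenEndpointR13SepCoPH :=
  fun F θ hP hG hθ _ _ =>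
    (spine_rec13CCoPHOn_iff_forall_guarded (fun F θ => θ.ZhUnity F 2 ∧ θ.SlotsNondegenerate₁₃ F 2)).mp
      (spine_rec13CCoPHOn_of_split (fun F θ => θ.ZhUnity F 2 ∧ θ.SlotsNondegenerate₁₃ F 2)
        (fun F (θ : Stage13HParams F 2) => θ.ppSel = ppSelLiveOfRecord F 2 θ.ν θ.τ9 (EOfRecord₁₃ F 2 θ.toStage13Params) (wOfRecord₉ F 2 θ.toStage9Params))
        (spine_rec13CCoPHOn_live_at_shellSplitOfRecord₁₃VAt_cut_of_keyedFacesP_cubeAC_massTV K₀ jc ρA ρB (fun F θ => θ.ZhUnity F 2 ∧ θ.SlotsNondegenerate₁₃ F 2) rr P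
          hζm h20 hρA hρB hM1 (fun F θ hP hRg hθ => hrates F θ hP hRg.1 hθ) h19)
        (spine_rec13CCoPHOn_of_keyedFacesP (cr := cr') (rr := rr)
          (Rg := fun F θ => (θ.ZhUnity F 2 ∧ θ.SlotsNondegenerate₁₃ F 2) ∧ ¬ θ.ppSel = ppSelLiveOfRecord F 2 θ.ν θ.τ9 (EOfRecord₁₃ F 2 θ.toStage13Params) (wOfRecord₉ F 2 θ.toStage9Params)) (P := P)
          h20' h21' (fun F θ hP hRg hθ => hrates F θ hP hRg.1 hθ) h19' hx'))
      F θ hP.toCore hG hθ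

end Summit.QuantumFields.YangMills.Theorems.BalabanUVNodesN27SpineRecord

end
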